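import Mathlib.Algebra.Group.Pi.Lemmas
import Mathlib.Algebra.Group.TypeTags.Hom
import Literature.IUT.HodgeArakelov.ThetaValueProfilesBridge
import Literature.IUT.HodgeArakelov.ThetaValueOrbitsProofs

/-!
# [IUTchII] Cor 2.8 (i) ⟹ Cor 3.5 (ii): restricting ONE class of `θ^ι_env` along chosen evaluation points is a
# value-profile — proof-only junction of `ThetaValueOrbits` (Cor 2.8), `ThetaValueProfilesBridge` and
# `BadPrimeGaussianMonoids` (Cor 3.5)

S. Mochizuki, *Inter-universal Teichmüller theory II*, kurims Dec-2020 manuscript, Cor 2.8 (i) p. 82 and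
Cor 3.5 (ii) p. 94 [cite: Mochizuki2012, Cor 3.5 (ii) p.94]: "by applying … the functorial algorithm [for
restricting elements of `θ^ι_env(M^Θ_*)`, `∞θ^ι_env(M^Θ_*)`] of Corollary 2.8, (i), (ii), one obtains …
`Ψ_ξ(M^Θ_*) := Ψ^×_cns(M^Θ_*)_{⟨F_l^⋇⟩} · ξ^ℕ` … where … `ξ` ranges over the value-profiles", a value-profile being
"an element of the set `θ^{F_l^⋇}_env(M^Θ_*▶) := ∏_{|t| ∈ F_l^⋇} θ^{|t|}_env(M^Θ_*▶)`". Claim key DISPUTED (D-0012).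
PROOF-ONLY junction file (abc-iut cell, layer L6, seat abc-iut-w4-d004; continuation of DISCHARGE-L6 §F row
F1 / `BadPrimeGaussianMonoidsProofs2.lean`, node IUTchII:Cor3.5(ii)); NO definition, NO `Prop` fact.

PROVED: for the OUTPUT of Cor 2.8 (i) (abc-iut-L6-t4's `ThetaValueOrbits.MonoThetaEvaluationData`: restriction
morphisms `res t` to the decomposition groups `D^δ_{t,μ_-}`, the `μ_{2l}`-orbit `θ^ι_env`, the orbits `θ^t_env`
depending only on `|t|`) and ANY choice `sec : F_l^⋇ → LabCusp^±` of cusps realising the labels `|t| ∈ F_l^⋇`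
(`lab = |·| ∘ sec`), restricting ANY single class `η ∈ θ^ι_env` gives a family
`ξ = (res (sec t) η)_t` that IS a value-profile of the value-profile data built by abc-iut-L6-t2's bridge
`ValueProfileData.ofMonoThetaEvaluationData` (`mem_valueProfiles_of_res`), and it is literally the value-profile
`(r_t θ)_t` of `BadPrimeGaussianMonoidsProofs2` for the multiplicative restriction morphisms
`r_t := (res (sec t)).toMultiplicative` (`toMultiplicative_res_apply`) — so the restriction isomorphism
`Ψ^ι_env ⥲ Ψ_ξ` of that file is onto the Gaussian monoid of a genuine value-profile; two classes of `θ^ι_env` give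
value-profiles with the same `Ψ_{2l·ξ}` (`gaussianMonoid2l_res_eq`). Nothing here takes a side on [IUTchIII]
Cor 3.12; typed ≠ proved ≠ endorsed.
-/

namespace Literature.IUT.HodgeArakelov

namespace BadPrimeGaussianMonoids

open ThetaValueOrbits

universe u v w

variable {twoL : ℕ} {LabCusp LabAbs : Type u} {abs : LabCusp → LabAbs} {H HG : Type v}
  [AddCommGroup H] [AddCommGroup HG] {T : Type w}

/-- **IUTchII:Cor2.8(i)** ⟹ **IUTchII:Cor3.5(ii)** (kurims p. 82, p. 94): restricting one class `η ∈ θ^ι_env` to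
the decomposition groups of chosen cusps `sec t` (`t ∈ F_l^⋇`, labels `|sec t|`) lands, at every label, in the
theta values `θ^{|t|}_env` of the value-profile data of the bridge — "`θ^t_env` … the `μ_{2l}`-orbits obtained by
restriction … depend only on the label `|t|`". [cite: Mochizuki2012, Cor 3.5 (ii) p.94] -/
theorem ofAdd_res_mem_thetaValues (D : MonoThetaEvaluationData twoL LabCusp LabAbs abs H HG)
    (habs : Function.Surjective abs) (hcard : (torsionTwoL (HG := HG) twoL).ncard = twoL) (h0 : 0 < twoL)
    (sec : T → LabCusp) {η : H} (hη : η ∈ D.thetaIota) (t : T) :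
    Multiplicative.ofAdd (D.res (sec t) η) ∈
      (ValueProfileData.ofMonoThetaEvaluationData D habs hcard h0 (abs ∘ sec)).thetaValues t := by
  rw [ValueProfileData.mem_ofMonoThetaEvaluationData, toAdd_ofAdd, Function.comp_apply, thetaAbs_eq]
  obtain ⟨η₀, hη₀, hT⟩ := D.thetaT_isOrbit (sec t)
  obtain ⟨η₁, hη₁⟩ := D.thetaIota_isOrbit
  rw [hT]
  have hηη₀ : η ∈ mu2lOrbit twoL η₀ := by
    rw [hη₁] at hη hη₀
    rw [mu2lOrbit_eq_of_mem hη₀]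
    exact hη
  rw [← mu2lOrbit_image_point (D.res (sec t)) twoL hηη₀]
  exact mem_mu2lOrbit_self twoL _

/-- **IUTchII:Cor3.5(ii)** (kurims p. 94) "`ξ` ranges over the value-profiles": the family of restrictions
`ξ = (res (sec t) η)_t` of ONE class `η ∈ θ^ι_env` IS a value-profile (an element of `θ^{F_l^⋇}_env = ∏ θ^{|t|}_env`)
of the bridge's value-profile data. [cite: Mochizuki2012, Cor 3.5 (ii) p.94] -/
theorem mem_valueProfiles_of_res [DecidableEq T] [Fintype T]
    (D : MonoThetaEvaluationData twoL LabCusp LabAbs abs H HG) (habs : Function.Surjective abs)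
    (hcard : (torsionTwoL (HG := HG) twoL).ncard = twoL) (h0 : 0 < twoL) (sec : T → LabCusp) {η : H}
    (hη : η ∈ D.thetaIota) :
    (fun t => Multiplicative.ofAdd (D.res (sec t) η)) ∈
      (ValueProfileData.ofMonoThetaEvaluationData D habs hcard h0 (abs ∘ sec)).valueProfiles := by
  rw [ValueProfileData.mem_valueProfiles]
  exact fun t => ofAdd_res_mem_thetaValues D habs hcard h0 sec hη t

/-- **IUTchII:Cor3.5(ii)** (kurims p. 94) dictionary: read multiplicatively (as in `BadPrimeGaussianMonoidsProofs2`,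
restriction morphisms `r_t : Multiplicative H →* Multiplicative HG`), the value-profile `(r_t θ)_t` of the class
`θ = η` IS the family of restrictions above. [cite: Mochizuki2012, Cor 3.5 (ii) p.94] -/
theorem toMultiplicative_res_apply (D : MonoThetaEvaluationData twoL LabCusp LabAbs abs H HG)
    (sec : T → LabCusp) (η : H) :
    (fun t => AddMonoidHom.toMultiplicative (D.res (sec t)) (Multiplicative.ofAdd η)) =
      fun t => Multiplicative.ofAdd (D.res (sec t) η) := rfl

/-- **IUTchII:Cor3.5(ii)** (kurims p. 95) "the submonoid `Ψ_{2l·ξ}(M^Θ_*)` … is independent of the value-profile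
`ξ`", for restrictions: two classes `η, η' ∈ θ^ι_env` restrict to value-profiles with the same `Ψ_{2l·ξ}` (both
are value-profiles of the same data; abc-iut-L6-t2's `ValueProfileData.gaussianMonoid2l_eq`).
[cite: Mochizuki2012, Cor 3.5 (ii) p.95] -/
theorem gaussianMonoid2l_res_eq [DecidableEq T] [Fintype T]
    (D : MonoThetaEvaluationData twoL LabCusp LabAbs abs H HG) (habs : Function.Surjective abs)
    (hcard : (torsionTwoL (HG := HG) twoL).ncard = twoL) (h0 : 0 < twoL) (sec : T → LabCusp) {η η' : H}
    (hη : η ∈ D.thetaIota) (hη' : η' ∈ D.thetaIota) :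
    gaussianMonoid2l twoL (fun t => Multiplicative.ofAdd (D.res (sec t) η)) =
      gaussianMonoid2l twoL (fun t => Multiplicative.ofAdd (D.res (sec t) η')) :=
  (ValueProfileData.ofMonoThetaEvaluationData D habs hcard h0 (abs ∘ sec)).gaussianMonoid2l_eq
    (mem_valueProfiles_of_res D habs hcard h0 sec hη) (mem_valueProfiles_of_res D habs hcard h0 sec hη')

end BadPrimeGaussianMonoids

end Literature.IUT.HodgeArakelov
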